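import Literature.MathematicalPhysics.QuantumLattice.OverlapLocality
import Literature.MathematicalPhysics.QuantumLattice.GaugeGroups
import HarnessLib

/-!
# Forward shift matrices of the discrete four-torus and the constant diagonal `SU(3)` twist

Topic `Literature/MathematicalPhysics/QuantumLattice`; namespace
`Literature.MathematicalPhysics.QuantumLattice`.

The site translation `x ↦ x + μ̂` of the periodic lattice `(ℤ/L)⁴` as a `0/1` matrix
`T_μ(x,y) = [y = x + μ̂]` (`torusShiftMat L μ`) — the `U ≡ 1` case of the gauge-covariant forward
shift `linkHop` of `OverlapLocality.lean` — with the algebra used by free-field computations on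
the torus: the `T_μ` pairwise commute, commute with every `T_νᴴ`, are unitary, and `T_μ^L = 1`
(Montvay–Münster 1994 §4.2, lattice momenta of the periodic torus; here in position space, so that
no Fourier analysis on `ZMod L` is needed).

Second part (`TwistedFreeWilson.*`): the constant twisted link `g = diag(e^{iθ}, e^{iθ}, e^{-2iθ}) ∈ SU(3)`,
`θ = π/(4L)` (`twistLink`, `twistCfg`), the twisted covariant shifts `F_μ = T_μ ⊗ g = linkHop` of
that field (`Fmat`, `linkHop_twistCfg`), their commutation/unitarity, and `g^{2L} = diag(i,i,-1)`,
which has no eigenvalue `1` (`twistDiag_pow_ne_one`) — the ingredient that excludes zero modes of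
the free Wilson operator at every mass (`TwistedFreeWilsonDirac.lean`; 't Hooft-type constant
abelian twists, Montvay–Münster 1994 §4.2).

Not here: eigen-decomposition / lattice momenta, antiperiodic shifts (see `WilsonDiracAP.lean`).
Origin: lean-checked by a stub worker of crux `PauliWegnerSea.FMClosureUnquenched`
(stmt-QuantumFields-11512), restyled for the Literature tree.
-/

noncomputable section

open scoped Kronecker ComplexOrder
open Matrix Complex
open Literature.MathematicalPhysics.QuantumFieldTheory
open Literature.Probability.LatticeModels (TorusSite)

namespace Literature.MathematicalPhysics.QuantumLattice

section Shift

variable {L : ℕ}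

/-- The forward site shift in direction `μ` on the torus `(ℤ/L)⁴` as a `0/1` matrix:
`T_μ(x,y) = [y = x + μ̂]`, i.e. `(T_μ ψ)(x) = ψ(x + μ̂)`. [folklore] -/
def torusShiftMat (L : ℕ) (μ : Fin 4) : Matrix (TorusSite 4 L) (TorusSite 4 L) ℂ :=
  Matrix.of fun x y => if y = Site.shift x μ then 1 else 0

/-- Entries of the shift matrix. [folklore] -/
@[simp] theorem torusShiftMat_apply (μ : Fin 4) (x y : TorusSite 4 L) :
    torusShiftMat L μ x y = if y = Site.shift x μ then 1 else 0 := rfl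

variable [NeZero L]

/-- The shifts commute: `T_μ T_ν = T_ν T_μ` (translations of an abelian group). [folklore] -/
theorem torusShiftMat_comm (μ ν : Fin 4) :
    torusShiftMat L μ * torusShiftMat L ν = torusShiftMat L ν * torusShiftMat L μ := by
  ext x z
  simp only [torusShiftMat, Matrix.mul_apply, Matrix.of_apply, boole_mul, Finset.sum_ite_eq',
    Finset.mem_univ, if_true]
  have : Site.shift (Site.shift x μ) ν = Site.shift (Site.shift x ν) μ := by
    simp only [Site.shift]; abel
  rw [this]

/-- `T_μ T_νᴴ = T_νᴴ T_μ`. [folklore] -/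
theorem torusShiftMat_mul_conjTranspose_comm (μ ν : Fin 4) :
    torusShiftMat L μ * (torusShiftMat L ν)ᴴ = (torusShiftMat L ν)ᴴ * torusShiftMat L μ := by
  ext x z
  simp only [torusShiftMat, Matrix.mul_apply, Matrix.conjTranspose_apply, Matrix.of_apply,
    star_ite_zero, star_one, boole_mul, Finset.sum_ite_eq', Finset.mem_univ, if_true]
  simp only [eq_shift_iff x, Finset.sum_ite_eq', Finset.mem_univ, if_true]
  have : (Site.shift x μ = Site.shift z ν) ↔ (z = Site.shift (x - Pi.single ν 1) μ) := by
    simp only [Site.shift]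
    constructor
    · intro h; linear_combination -h
    · intro h; linear_combination -h
  exact if_congr this rfl rfl

/-- The shift is unitary: `T_μ T_μᴴ = 1`. [folklore] -/
theorem torusShiftMat_mul_conjTranspose_self (μ : Fin 4) :
    torusShiftMat L μ * (torusShiftMat L μ)ᴴ = 1 := by
  ext x z
  simp only [torusShiftMat, Matrix.mul_apply, Matrix.conjTranspose_apply, Matrix.of_apply,
    star_ite_zero, star_one, boole_mul, Finset.sum_ite_eq', Finset.mem_univ, if_true]
  simp only [Matrix.one_apply, Site.shift, add_left_inj]

/-- Powers of the shift: `T_μ^k (x,y) = [y = x + k μ̂]`. [folklore] -/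
theorem torusShiftMat_pow (μ : Fin 4) (k : ℕ) :
    torusShiftMat L μ ^ k =
      Matrix.of fun x y => if y = x + k • Pi.single μ (1 : ZMod L) then 1 else 0 := by
  induction k with
  | zero =>
      ext x y
      simp only [pow_zero, Matrix.one_apply, Matrix.of_apply, zero_smul, add_zero, eq_comm]
  | succ k ih =>
      ext x z
      rw [pow_succ, ih]
      simp only [torusShiftMat, Matrix.mul_apply, Matrix.of_apply, boole_mul, Finset.sum_ite_eq',
        Finset.mem_univ, if_true, Site.shift, succ_nsmul, add_assoc]

/-- **Periodicity**: `T_μ^L = 1` on the torus of side `L`. [folklore] -/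
theorem torusShiftMat_pow_self (μ : Fin 4) : torusShiftMat L μ ^ L = 1 := by
  rw [torusShiftMat_pow]
  ext x y
  have h0 : (L : ℕ) • Pi.single μ (1 : ZMod L) = (0 : TorusSite 4 L) := by
    ext i
    simp [Pi.single_apply, nsmul_eq_mul]
  simp only [h0, add_zero, Matrix.of_apply, Matrix.one_apply, eq_comm]

omit [NeZero L] in
/-- The gauge-covariant forward shift of a CONSTANT link field `U ≡ g` is `T_μ ⊗ ρ(g)`
(site ⊗ colour). [folklore] -/
theorem linkHop_const {G : Type*} [Group G] {N : ℕ} (ρ : G →* Matrix (Fin N) (Fin N) ℂ) (g : G)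
    (μ : Fin 4) :
    linkHop ρ (fun _ : QuantumFieldTheory.Edge 4 L => g) μ =
      torusShiftMat L μ ⊗ₖ ρ g := by
  ext ⟨x, a⟩ ⟨y, b⟩
  simp only [linkHop, torusShiftMat, Matrix.of_apply, Matrix.kroneckerMap_apply, boole_mul]

end Shift

/-! ## The constant diagonal `SU(3)` twist and its covariant shifts

A constant link field `U₀ ≡ g = diag(e^{iθ}, e^{iθ}, e^{-2iθ})`, `θ = π/(4L)`, for which the twisted
forward shifts `F_μ = T_μ ⊗ g` are commuting unitaries with `F_μ^{2L} = 1 ⊗ diag(i, i, -1)` — no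
eigenvalue `1` — the input of the zero-mode exclusion in `TwistedFreeWilsonDirac.lean`. -/

namespace TwistedFreeWilson

local notation "𝔾" => Matrix.specialUnitaryGroup (Fin 3) ℂ

/-! ### The twisted link -/

variable {L : ℕ}

/-- The twist angles `(θ, θ, -2θ)`, `θ = π/(4L)`. [folklore] -/
def twistArg (L : ℕ) : Fin 3 → ℝ :=
  ![Real.pi / (4 * L), Real.pi / (4 * L), -(2 * (Real.pi / (4 * L)))]

/-- The diagonal phases `e^{iθ_a}`. [folklore] -/
def twistDiag (L : ℕ) : Fin 3 → ℂ := fun a => Complex.exp (twistArg L a * Complex.I)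

/-- The twist phases are unimodular. [folklore] -/
theorem twistDiag_mul_conj (a : Fin 3) : twistDiag L a * star (twistDiag L a) = 1 := by
  rw [Complex.star_def, Complex.mul_conj, Complex.normSq_eq_norm_sq, twistDiag,
    Complex.norm_exp_ofReal_mul_I]
  simp

/-- The twisted link `g = diag(e^{iθ}, e^{iθ}, e^{-2iθ})` lies in `SU(3)`. [folklore] -/
theorem twistMat_mem : Matrix.diagonal (twistDiag L) ∈ Matrix.specialUnitaryGroup (Fin 3) ℂ := by
  rw [Matrix.mem_specialUnitaryGroup_iff, Matrix.mem_unitaryGroup_iff, Matrix.det_diagonal]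
  refine ⟨?_, ?_⟩
  · rw [Matrix.star_eq_conjTranspose, Matrix.diagonal_conjTranspose, Matrix.diagonal_mul_diagonal,
      ← Matrix.diagonal_one]
    congr 1
    funext a
    exact twistDiag_mul_conj a
  · rw [Fin.prod_univ_three]
    simp only [twistDiag, twistArg, ← Complex.exp_add]
    convert Complex.exp_zero using 2
    simp only [Matrix.cons_val_zero, Matrix.cons_val_one, Matrix.cons_val_two,
      Matrix.tail_cons, Matrix.head_cons]
    push_cast
    ring

/-- `g gᴴ = 1` for the twisted link. [folklore] -/
theorem twist_mul_conjTranspose :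
    Matrix.diagonal (twistDiag L) * (Matrix.diagonal (twistDiag L))ᴴ = 1 := by
  have h := (Matrix.mem_specialUnitaryGroup_iff.1 (twistMat_mem (L := L))).1
  rwa [Matrix.mem_unitaryGroup_iff, Matrix.star_eq_conjTranspose] at h

/-- `gᴴ g = 1` for the twisted link. [folklore] -/
theorem twist_conjTranspose_mul :
    (Matrix.diagonal (twistDiag L))ᴴ * Matrix.diagonal (twistDiag L) = 1 := by
  have h := (Matrix.mem_specialUnitaryGroup_iff.1 (twistMat_mem (L := L))).1
  rwa [Matrix.mem_unitaryGroup_iff', Matrix.star_eq_conjTranspose] at h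

variable [NeZero L]

/-- `g^{2L} = diag(i, i, -1)` has no eigenvalue `1`: `(e^{iθ_a})^{2L} ≠ 1`. [folklore] -/
theorem twistDiag_pow_ne_one (a : Fin 3) : twistDiag L a ^ (2 * L) ≠ 1 := by
  have hL : (L : ℂ) ≠ 0 := Nat.cast_ne_zero.2 (NeZero.ne L)
  rw [twistDiag, ← Complex.exp_nat_mul]
  fin_cases a
  · -- `exp(i π/2) = i`
    have : ((2 * L : ℕ) : ℂ) * ((twistArg L 0 : ℝ) * Complex.I) = (Real.pi / 2 : ℝ) * Complex.I := by
      simp only [twistArg, Matrix.cons_val_zero]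
      push_cast
      field_simp
      ring
    rw [show (⟨0, by norm_num⟩ : Fin 3) = 0 from rfl, this, Complex.exp_mul_I]
    intro h
    have h' := congrArg Complex.re h
    simp at h'
  · have : ((2 * L : ℕ) : ℂ) * ((twistArg L 1 : ℝ) * Complex.I) = (Real.pi / 2 : ℝ) * Complex.I := by
      simp only [twistArg, Matrix.cons_val_one]
      push_cast
      field_simp
      ring
    rw [show (⟨1, by norm_num⟩ : Fin 3) = 1 from rfl, this, Complex.exp_mul_I]
    intro h
    have h' := congrArg Complex.re h
    simp at h'
  · -- `exp(-i π) = -1`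
    have : ((2 * L : ℕ) : ℂ) * ((twistArg L 2 : ℝ) * Complex.I) = (-Real.pi : ℝ) * Complex.I := by
      simp only [twistArg, Matrix.cons_val_two, Matrix.tail_cons, Matrix.head_cons]
      push_cast
      field_simp
      ring
    rw [show (⟨2, by norm_num⟩ : Fin 3) = 2 from rfl, this, Complex.exp_mul_I]
    intro h
    have h' := congrArg Complex.re h
    simp at h'
    norm_num at h'

/-! ### The constant twisted gauge field and its Wilson operator in Kronecker form -/

/-- The twisted link as an element of `SU(3)`. [folklore] -/
def twistLink (L : ℕ) : 𝔾 := ⟨Matrix.diagonal (twistDiag L), twistMat_mem⟩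

/-- The constant twisted gauge field `U₀ ≡ g`. [folklore] -/
def twistCfg (L : ℕ) : GaugeConfig 4 L 𝔾 := fun _ => twistLink L

variable (L)

/-- Site × colour index. [folklore] -/
abbrev VIdx : Type := TorusSite 4 L × Fin 3

/-- The twisted forward shift `F_μ = T_μ ⊗ g`. [folklore] -/
def Fmat (μ : Fin 4) : Matrix (VIdx L) (VIdx L) ℂ := torusShiftMat L μ ⊗ₖ Matrix.diagonal (twistDiag L)

variable {L}

omit [NeZero L] in
/-- `F_μ = linkHop` of the twisted field. [folklore] -/
theorem linkHop_twistCfg (μ : Fin 4) : linkHop (fundamentalRep (Fin 3)) (twistCfg L) μ = Fmat L μ := by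
  ext ⟨x, a⟩ ⟨y, b⟩
  simp only [linkHop, twistCfg, twistLink, Fmat, torusShiftMat, Matrix.of_apply,
    Matrix.kroneckerMap_apply, fundamentalRep_apply, boole_mul]

/-- The twisted shifts commute. [folklore] -/
theorem Fmat_comm (μ ν : Fin 4) : Fmat L μ * Fmat L ν = Fmat L ν * Fmat L μ := by
  rw [Fmat, Fmat, ← mul_kronecker_mul, ← mul_kronecker_mul, torusShiftMat_comm]

/-- `F_μ F_νᴴ = F_νᴴ F_μ`. [folklore] -/
theorem Fmat_mul_conjTranspose_comm (μ ν : Fin 4) :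
    Fmat L μ * (Fmat L ν)ᴴ = (Fmat L ν)ᴴ * Fmat L μ := by
  rw [Fmat, Fmat, conjTranspose_kronecker, ← mul_kronecker_mul, ← mul_kronecker_mul,
    torusShiftMat_mul_conjTranspose_comm, twist_mul_conjTranspose, twist_conjTranspose_mul]

/-- `F_μ F_μᴴ = 1` (the twisted shifts are unitary). [folklore] -/
theorem Fmat_mul_conjTranspose_self (μ : Fin 4) : Fmat L μ * (Fmat L μ)ᴴ = 1 := by
  rw [Fmat, conjTranspose_kronecker, ← mul_kronecker_mul, twist_mul_conjTranspose,
    torusShiftMat_mul_conjTranspose_self, one_kronecker_one]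

end TwistedFreeWilson

end Literature.MathematicalPhysics.QuantumLattice

end
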